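import Summits.QuantumFields.YangMills.Theorems.AllWindowsColdBoxDirichletPoincareSums

/-!
# LINE-17 of crux `BoxMidWindowsSU22` (stmt-QuantumFields-24003), stub D `DirPoincareCubic` — part 3/3:
# registered stub `stub_dirPoincareCubic : DirPoincareCubic` BY NAME, `λ_max(Q_D⁻¹) ≤ 4000·H³`

From the abstract Poincaré inequality of part 2 (`sum_sq_boxEdges_le`, applied to the glued free variables `dirGlue H v`, whose
Dirichlet form is `vᵀ Q_D v`: `dotProduct_Qmat_eq`, and whose squared edge values dominate `‖v‖²`: `sum_sq_le_sum_boxEdges`) and the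
matrix lemma `dotProduct_inv_mulVec_le` (`‖w‖² ≤ c·wᵀQw ∀w` ⇒ `vᵀQ⁻¹v ≤ c‖v‖²` for positive definite `Q`, Cauchy–Schwarz with
`w = Q⁻¹v`): `dirQmat_inv_le : vᵀ Q_D⁻¹ v ≤ 4000·H³·‖v‖²` for `H ≥ 1`, and the registered obligation D of LINE-17 (skeleton v3 sha16
`4747b363e792659d`, planner ym-idea-2 g14, critic idea-crit-4 g8 PASS 2026-08-29) with its Prop restated VERBATIM so that the stub
lands by name and signature.  The constant `4000` is crude (STUB-MAP §D measured `λ_max ≈ H^{2.2}`); the line only needs `O(H³)`.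
Also the D-component of LINE-18's stub S2 `stub_flatTiltInputs` on the sibling crux `BulkMidWindowSU2` (stmt-QuantumFields-24006).
BY-PRODUCT for obligation C (`DirFreeVarLinear`, NOT proved here): the per-edge bounds of part 1 give `(Q_D⁻¹)_{ee} ≤ O(H)` for
spatial and face-temporal free edges, but only `O(H²)` for the bottom temporal edges — C as typed needs the 3-d spreading flow of
STUB-MAP §C(iii).  HONEST LABEL: glue obligation on the R2ξ″ RECORD-rung cruxes 24003/24006; no crux, rung or summit is proved;
the Clay Yang–Mills mass gap is NOT proved by any of this.
-/

set_option autoImplicit false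

noncomputable section

open Finset
open scoped Matrix
open Literature.Probability.LatticeModels (Site mem_halfOpenBox halfOpenBox)
open Literature.MathematicalPhysics.QuantumFieldTheory
open Literature.MathematicalPhysics.QuantumFieldTheory.LatticeMaxwell
open Literature.MathematicalPhysics.QuantumFieldTheory.AxialGauge

namespace Summit.QuantumFields.YangMills.Theorems.AllWindowsColdBox.DirPoincare

open Summit.QuantumFields.YangMills.Theorems.WeakCouplingRates

/-! ## From the Poincaré inequality to `λ_max(Q_D⁻¹) ≤ c·H³` -/

/-- **Matrix lemma**: for a positive definite real matrix `Q`, a lower form bound `‖w‖² ≤ c · wᵀQw` for all `w` gives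
`vᵀQ⁻¹v ≤ c‖v‖²` for all `v` (Cauchy–Schwarz with `w = Q⁻¹v`). -/
theorem dotProduct_inv_mulVec_le {ι : Type*} [Fintype ι] [DecidableEq ι] (Q : Matrix ι ι ℝ) (hQ : Q.PosDef)
    {c : ℝ} (hc : 0 ≤ c) (h : ∀ w : ι → ℝ, w ⬝ᵥ w ≤ c * (w ⬝ᵥ Q *ᵥ w)) (v : ι → ℝ) :
    v ⬝ᵥ Q⁻¹ *ᵥ v ≤ c * (v ⬝ᵥ v) := by
  set w := Q⁻¹ *ᵥ v with hw
  have hdet : IsUnit Q.det := (Matrix.isUnit_iff_isUnit_det Q).1 hQ.isUnit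
  have hQw : Q *ᵥ w = v := by rw [hw, Matrix.mulVec_mulVec, Matrix.mul_nonsing_inv Q hdet, Matrix.one_mulVec]
  have hww : w ⬝ᵥ w ≤ c * (w ⬝ᵥ v) := by have := h w; rwa [hQw] at this
  have hcs : (w ⬝ᵥ v) ^ 2 ≤ (w ⬝ᵥ w) * (v ⬝ᵥ v) := by
    have := Finset.sum_mul_sq_le_sq_mul_sq Finset.univ w v
    simpa only [dotProduct, sq] using this
  have hvv : 0 ≤ v ⬝ᵥ v := by
    simp only [dotProduct]; exact Finset.sum_nonneg fun i _ => mul_self_nonneg (v i)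
  rw [dotProduct_comm]
  by_cases hE : w ⬝ᵥ v ≤ 0
  · exact hE.trans (mul_nonneg hc hvv)
  · push Not at hE
    nlinarith [mul_nonneg hc hvv]

/-- The squared free variables are among the squared glued edge values on the cold box. -/
theorem sum_sq_le_sum_boxEdges {H : ℕ} (v : DirFree H → ℝ) :
    v ⬝ᵥ v ≤ ∑ e ∈ boxEdges 4 (2 * H + 1), dirGlue H v e ^ 2 := by
  classical
  have h1 : v ⬝ᵥ v = ∑ e : DirFree H, dirGlue H v e.1.1 ^ 2 := by
    simp only [dotProduct]
    exact Finset.sum_congr rfl fun e _ => by rw [dirGlue, glue_apply_free]; ring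
  rw [h1]
  have hinj : Set.InjOn (fun e : DirFree H => e.1.1) (Finset.univ : Finset (DirFree H)) :=
    fun a _ b _ hab => Subtype.ext (Subtype.ext hab)
  rw [← Finset.sum_image (f := fun e' => dirGlue H v e' ^ 2) hinj]
  refine Finset.sum_le_sum_of_subset_of_nonneg (fun e' he' => ?_) fun _ _ _ => sq_nonneg _
  obtain ⟨e, -, rfl⟩ := Finset.mem_image.1 he'
  exact (mem_dirFreeEdges.1 (not_not.1 e.2)).1

/-- The Dirichlet form as the sum of squared circulations over the (translated) plaquettes of the enlarged box. -/
theorem dotProduct_Qmat_eq {H : ℕ} (v : DirFree H → ℝ) :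
    v ⬝ᵥ Qmat (fun e => e ∉ dirFreeEdges H) dirCorner (2 * H + 3) *ᵥ v =
      ∑ q ∈ (plaquettesIn (halfOpenBox 4 (2 * H + 3))).image (Plaq.shift dirCorner), sCirc (dirGlue H v) q ^ 2 := by
  rw [dotProduct_Qmat_mulVec, formM, Finset.sum_image fun p _ q _ hpq => Plaq.shift_injective _ hpq]

/-- **λ_max(Q_D⁻¹) ≤ 4000·H³**: the quadratic form of the inverse Dirichlet precision matrix is bounded by `4000·H³·‖v‖²`. -/
theorem dirQmat_inv_le {H : ℕ} (hH : 1 ≤ H) (v : DirFree H → ℝ) :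
    v ⬝ᵥ (Qmat (fun e => e ∉ dirFreeEdges H) dirCorner (2 * H + 3))⁻¹ *ᵥ v ≤ 4000 * (H : ℝ) ^ 3 * (v ⬝ᵥ v) := by
  refine dotProduct_inv_mulVec_le _ (posDef_dirQmat H) (by positivity) (fun w => ?_) v
  rw [dotProduct_Qmat_eq]
  refine (sum_sq_le_sum_boxEdges w).trans ?_
  exact sum_sq_boxEdges_le (dirGlue H w) (fun e he => dirGlue_eq_zero_of_not_mem w he)
    (fun x hx => dirGlue_eq_zero_of_forest w hx) _ (fun _ _ => rfl) _ rfl hH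

/-! ## The registered stub, by name -/

/-- **Obligation D of LINE-17, restated verbatim** from the registered skeleton v3 (sha16 `4747b363e792659d`,
`Summit.QuantumFields.YangMills.Cruxes.BoxMidWindowsSU22.BirthV3.DirPoincareCubic`): the ℓ² forest Poincaré inequality
`λ_max(Q_D⁻¹) ≤ c·H³` for the temporal-gauge Dirichlet precision matrix of the cold-wall box. -/
def DirPoincareCubic : Prop :=
  ∃ c : ℝ, 0 < c ∧ ∀ H : ℕ, 1 ≤ H → ∀ v : DirFree H → ℝ,
    dotProduct v ((Qmat (fun e => e ∉ dirFreeEdges H) dirCorner (2 * H + 3))⁻¹.mulVec v) ≤ c * (H : ℝ) ^ 3 * dotProduct v v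

/-- **Registered stub D of LINE-17 (crux 24003), by name**: `λ_max(Q_D⁻¹) ≤ 4000·H³`. -/
theorem stub_dirPoincareCubic : DirPoincareCubic :=
  ⟨4000, by norm_num, fun H hH v => dirQmat_inv_le hH v⟩

end Summit.QuantumFields.YangMills.Theorems.AllWindowsColdBox.DirPoincare

end
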